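import Summits.ResolutionOfSingularities.ResolutionOfSingularities.Theorems.WeightedInvariantLocalWeightedDropNCDirectrixCutWeierstrass
import Summits.ResolutionOfSingularities.ResolutionOfSingularities.Theorems.WeightedInvariantLocalWeightedDropNCDirectrixCutHist
import Summits.ResolutionOfSingularities.ResolutionOfSingularities.Theorems.WeightedInvariantLocalWeightedDropNCResRegimeDefs
import Summits.ResolutionOfSingularities.ResolutionOfSingularities.Theorems.WeightedInvariantLocalWeightedDropNCDirectrixCutWeierstrassFactors
import Summits.ResolutionOfSingularities.ResolutionOfSingularities.Theorems.WeightedInvariantLocalWeightedDropNCDirectrixCutPairLift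
import Summits.ResolutionOfSingularities.ResolutionOfSingularities.Theorems.WeightedInvariantLocalWeightedDropNCDirectrixCutMonomialPair
import Summits.ResolutionOfSingularities.ResolutionOfSingularities.Theorems.WeightedInvariantLocalWeightedDropNCResSurfaceBoundaryNCThreeHolds

/-!
# `WeightedInvariant.LocalWeightedDrop` (stmt-ResolutionOfSingularities-8899), registered stub W′|₄ `stub_wildWideApexFourStartsWon`,
# line `directrix-cut`, ORDER-`p` split: the corner R₂ CLOSED IN THE KERNEL and the `(p, o) = (2, 2)` GOOD corner reduced to C alone

[OURS · route `ResolutionOfSingularities/WeightedInvariant` · ENGINE crux `LocalWeightedDrop` (stmt-ResolutionOfSingularities-8899), skeleton v36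
`ae852bbacee88029`, registered stub `stub_wildWideApexFourStartsWon` (W′|₄) · res-L1-w43-strat-1's sub-skeleton chain of record: line v3f ⊃ unary
position split (`g9/unary_position_split_v1.lean` 44515f1b12c79086, `g10/…_v2`) ⊃ ORDER-`p` split (`g10/orderp_split_v2.lean`: stubs F · R · C · T ·
Core) ⊃ smooth-pair split of R at `p = 2` (`g11/r2_split_v1.lean` e295f84f594a1ad7: SNC₂ · MONO₂).  Candidates of the programme's own count game —
nothing here is a statement of, or about, any manuscript; AI-written, weaker than expert review; counted 0; proves no summit.]

## What this file does (pure assembly of LANDED theorems; no definition, no new axiom)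

The strategist's `p = 2` cut of R reads: two smooth branches `Φ^* f = u · (x₀ + g₁)(x₀ + g₂)` in base-boundary position at `o = 2` EXIT, from
SNC₂ (`stub_smoothPairToMonomial`: reach EXIT or a MONOMIAL PAIR position with the same head) and MONO₂ (`stub_monomialPairExit`), by
`DWinsTo.bind` (`r2_split_v1.smoothPairTwo_of`, kernel-checked there modulo the two stubs).  Since then every input LANDED:

* D₃ᴮ — `TameFourTupleDrop.surfaceBoundaryNC₃` (res-L1-w43-lead-1 g6, `…NCResSurfaceBoundaryNCThreeHolds`, p587204): the `m = 2` decorated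
  normal-crossings game with empty history is won by B-permissible moves with transform successors, every prime characteristic;
* LIFT — `TameFourTupleDrop.PairLift.pairLift_three` (res-L1-w43-stub-4, `…NCDirectrixCutPairLift`): the x₀-transport D₃ᴮ ⇒ SNC₂, with the
  characteristic binders `(p) (hp) [CharP k p]` of D₃ᴮ carried onto the conclusion (the strategist's `stub_pairLift`/`stub_smoothPairToMonomial`
  quantify over ALL algebraically closed fields while D₃ᴮ is typed in prime characteristic only — the consumer reads `p = 2`, so nothing is lost);
* MONO₂ — `TameFourTupleDrop.MonomialPair.monomialPairExit` (res-L1-w43-stub-4, `…NCDirectrixCutMonomialPair`, p578770), characteristic-free;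
* F — `TameFourTupleDrop.weierstrassFactorsOfReducible`, T — `TameFourTupleDrop.cpScopeOfTwoIrred` (res-L1-w43-strat-1 g11 via o4,
  `…NCDirectrixCutWeierstrassFactors`): Weierstrass factorisation of a reducible order-`p` presentation; CP scope of an irreducible double point.

Hence, in this file:

1. `smoothPairToMonomial_charP` — SNC₂ IN EVERY PRIME CHARACTERISTIC (`:= pairLift_three surfaceBoundaryNC₃`);
2. `smoothPairTwo_charP` — **R₂ IN EVERY PRIME CHARACTERISTIC, sorry-free**: two smooth branches at `o = 2` in base-boundary position exit
   (the strategist's `smoothPairTwo_of`, re-run on the landed inputs);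
3. `charTwoUnaryDoublePointsGood_of_cpScope` — the unary-position-split stub `stub_charTwoUnaryDoublePointsGood` (`(p, o) = (2, 2)`, GOOD
   position) VERBATIM from the SINGLE remaining hypothesis C = `stub_cpScopeIrredOrderP` VERBATIM (the strategist's
   `charTwoUnaryDoublePointsGood_of_v3 : F → R₂ → C → T → stub` with F, R₂, T discharged by name).

So after this file the `(2, 2)` GOOD corner of W′|₄ rests on C alone (res-L1-w43-strat-1 g11 cut C = PREP ⊕ RUN modulo the Literature fact
`CossartPiltant2019_exitMultiplicityP_independent'`, with the recorded sub-gap (d2′) «NC with E» for `κ ∈ {3, 4}`; `g11/cpscope_split_v1.lean`).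
Remaining named pieces of W′|₄ elsewhere in the chain are untouched (`stub_badPlaneThree`, the odd-`p` core `stub_irredOutsideCPScopeOddP`,
the letter/bad escapes and FT₃ of the unary split, the other v3f stubs).
-/

set_option linter.dupNamespace false -- mandated namespace of this single-conjunct summit

noncomputable section

namespace Summit.ResolutionOfSingularities.ResolutionOfSingularities.Theorems

namespace TameFourTupleDrop

open MvPowerSeries Literature.AlgebraicGeometry.Resolution

/-- **SNC₂ in every prime characteristic** (res-L1-w43-strat-1's `stub_smoothPairToMonomial` with the binders `(p) (hp) [CharP k p]`): from two
smooth branches `Φ^* f = u · (x₀ + g₁)(x₀ + g₂)` in base-boundary position at `o = 2`, empty history, the mover reaches EXIT (normal crossing, head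
drop, or equal head off the unary vertex) or a MONOMIAL PAIR position `Φ'^* f' = u' · x₀ (x₀ + v · x^α)` with the same head.  Proof: the landed
x₀-lift `PairLift.pairLift_three` fed with the landed surface engine D₃ᴮ `surfaceBoundaryNC₃`. [OURS · W′|₄ assembly] -/
theorem smoothPairToMonomial_charP :
    ∀ (p : ℕ), p.Prime → ∀ (k : Type) [Field k] [CharP k p] [IsAlgClosed k],
      ∀ (b : MvPowerSeries (Fin 4) k) (δ : Decoration k 3) (Φ : Fin 4 → MvPowerSeries (Fin 4) k) (u g₁ g₂ : MvPowerSeries (Fin 4) k),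
        Admissible b δ → δ.O = ∅ → δ.o = 2 →
        (∀ i, constantCoeff (Φ i) = 0) → IsUnit (Matrix.det (Matrix.of fun i j => coeff (Finsupp.single j 1) (Φ i))) →
        (∀ l ∈ δ.E, ∃ (l' : Fin 4) (v : MvPowerSeries (Fin 4) k), l' ≠ 0 ∧ constantCoeff v ≠ 0 ∧ Φ l = v * X l') →
        constantCoeff u ≠ 0 → (∀ n : Fin 4 →₀ ℕ, n 0 ≠ 0 → coeff n g₁ = 0) → (∀ n : Fin 4 →₀ ℕ, n 0 ≠ 0 → coeff n g₂ = 0) →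
        subst Φ δ.f = u * ((X 0 + g₁) * (X 0 + g₂)) →
        DWinsTo (St := MvPowerSeries (Fin 4) k × Decoration k 3) Prod.fst
          (fun τ => (GermIsNC τ.1 ∨ (Admissible τ.1 τ.2 ∧ (τ.2.head < δ.head ∨ (τ.2.head = δ.head ∧ ¬ UnaryVertex τ.2)))) ∨
            (Admissible τ.1 τ.2 ∧ τ.2.head = δ.head ∧ τ.2.O = ∅ ∧ τ.2.o = 2 ∧
              ∃ (Φ' : Fin 4 → MvPowerSeries (Fin 4) k) (u' v : MvPowerSeries (Fin 4) k) (α : Fin 3 → ℕ),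
                (∀ i, constantCoeff (Φ' i) = 0) ∧ IsUnit (Matrix.det (Matrix.of fun i j => coeff (Finsupp.single j 1) (Φ' i))) ∧
                (∀ l ∈ τ.2.E, ∃ (l' : Fin 4) (w : MvPowerSeries (Fin 4) k), l' ≠ 0 ∧ constantCoeff w ≠ 0 ∧ Φ' l = w * X l') ∧
                constantCoeff u' ≠ 0 ∧ constantCoeff v ≠ 0 ∧
                subst Φ' τ.2.f = u' * (X 0 * (X 0 + v * ∏ i : Fin 3, X (Fin.succ i) ^ α i))))
          (b, δ) :=
  PairLift.pairLift_three surfaceBoundaryNC₃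

/-- **R₂ in every prime characteristic — two smooth branches at `o = 2` in base-boundary position EXIT** (res-L1-w43-strat-1's concluder
`smoothPairTwo_of` run on the landed SNC₂ (`smoothPairToMonomial_charP`) and MONO₂ (`MonomialPair.monomialPairExit`); `DWinsTo.bind`, the equal
heads identify the exit targets). [OURS · W′|₄ assembly] -/
theorem smoothPairTwo_charP :
    ∀ (p : ℕ), p.Prime → ∀ (k : Type) [Field k] [CharP k p] [IsAlgClosed k],
      ∀ (b : MvPowerSeries (Fin 4) k) (δ : Decoration k 3) (Φ : Fin 4 → MvPowerSeries (Fin 4) k) (u g₁ g₂ : MvPowerSeries (Fin 4) k),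
        Admissible b δ → δ.O = ∅ → δ.o = 2 →
        (∀ i, constantCoeff (Φ i) = 0) → IsUnit (Matrix.det (Matrix.of fun i j => coeff (Finsupp.single j 1) (Φ i))) →
        (∀ l ∈ δ.E, ∃ (l' : Fin 4) (v : MvPowerSeries (Fin 4) k), l' ≠ 0 ∧ constantCoeff v ≠ 0 ∧ Φ l = v * X l') →
        constantCoeff u ≠ 0 → (∀ n : Fin 4 →₀ ℕ, n 0 ≠ 0 → coeff n g₁ = 0) → (∀ n : Fin 4 →₀ ℕ, n 0 ≠ 0 → coeff n g₂ = 0) →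
        subst Φ δ.f = u * ((X 0 + g₁) * (X 0 + g₂)) →
        DWinsTo (St := MvPowerSeries (Fin 4) k × Decoration k 3) Prod.fst
          (fun τ => GermIsNC τ.1 ∨ (Admissible τ.1 τ.2 ∧ (τ.2.head < δ.head ∨ (τ.2.head = δ.head ∧ ¬ UnaryVertex τ.2)))) (b, δ) := by
  intro p hp k _ _ _ b δ Φ u g₁ g₂ hadm hO ho hΦ0 hdet hE hu hg₁ hg₂ hsub
  refine (smoothPairToMonomial_charP p hp k b δ Φ u g₁ g₂ hadm hO ho hΦ0 hdet hE hu hg₁ hg₂ hsub).bind ?_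
  rintro ⟨b', δ'⟩ hτ
  rcases hτ with hexit | ⟨hadm', hhead, hO', ho', Φ', u', v, α, hΦ0', hdet', hE', hu', hv, hsub'⟩
  · exact DWinsTo.of_target hexit
  · have h := MonomialPair.monomialPairExit k b' δ' Φ' u' v α hadm' hO' ho' hΦ0' hdet' hE' hu' hv hsub'
    rw [hhead] at h
    exact h

/-- **The `(p, o) = (2, 2)` GOOD corner of W′|₄ from C alone**: res-L1-w43-strat-1's unary-position-split stub
`stub_charTwoUnaryDoublePointsGood` VERBATIM (characteristic `2`, unary vertex, empty history, `o = 2`, GOOD directrix position ⇒ the mover forces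
EXIT), assuming only the ORDER-`p`-split stub C = `stub_cpScopeIrredOrderP` VERBATIM (irreducible order-`p` presentations in Cossart–Piltant scope
exit).  This is the strategist's concluder `charTwoUnaryDoublePointsGood_of_v3 : F → R₂ → C → T → stub` with F (`weierstrassFactorsOfReducible`),
R₂ (`smoothPairTwo_charP 2`), T (`cpScopeOfTwoIrred`) DISCHARGED BY NAME: take a base-boundary Weierstrass witness of the good direction
(`Decoration.exists_weierstrassWitness_of_goodDir`); an irreducible `hW` is in CP scope by T and exits by C; a reducible one factors by F with
`d₁ = d₂ = 1` and exits by R₂. [OURS · W′|₄ assembly] -/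
theorem charTwoUnaryDoublePointsGood_of_cpScope
    (hC :
    ∀ (p : ℕ), p.Prime → ∀ (k : Type) [Field k] [CharP k p] [IsAlgClosed k],
      ∀ (b : MvPowerSeries (Fin 4) k) (δ : Decoration k 3) (Φ : Fin 4 → MvPowerSeries (Fin 4) k) (u hW : MvPowerSeries (Fin 4) k)
        (a : ℕ → MvPowerSeries (Fin 4) k),
        Admissible b δ → δ.O = ∅ → δ.o = p →
        (∀ i, constantCoeff (Φ i) = 0) → IsUnit (Matrix.det (Matrix.of fun i j => coeff (Finsupp.single j 1) (Φ i))) →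
        (∀ l ∈ δ.E, ∃ (l' : Fin 4) (v : MvPowerSeries (Fin 4) k), l' ≠ 0 ∧ constantCoeff v ≠ 0 ∧ Φ l = v * X l') →
        constantCoeff u ≠ 0 → (∀ i (n : Fin 4 →₀ ℕ), n 0 ≠ 0 → coeff n (a i) = 0) →
        hW = X 0 ^ p + ∑ i ∈ Finset.range p, a i * X 0 ^ i → subst Φ δ.f = u * hW →
        Irreducible hW →
        ((∀ i, 0 < i → i < p → a i = 0) ∨
          (∃ G : MvPowerSeries (Fin 4) k, (hW ∣ G ^ p + ∑ i ∈ Finset.range p, a i * G ^ i) ∧ ¬ (hW ∣ G - X 0))) →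
        DWinsTo (St := MvPowerSeries (Fin 4) k × Decoration k 3) Prod.fst
          (fun τ => GermIsNC τ.1 ∨ (Admissible τ.1 τ.2 ∧ (τ.2.head < δ.head ∨ (τ.2.head = δ.head ∧ ¬ UnaryVertex τ.2)))) (b, δ)) :
    ∀ (k : Type) [Field k] [CharP k 2] [IsAlgClosed k],
      ∀ (b : MvPowerSeries (Fin 4) k) (δ : Decoration k 3), Admissible b δ → UnaryVertex δ → δ.O = ∅ → δ.o = 2 → δ.GoodDir →
        DWinsTo (St := MvPowerSeries (Fin 4) k × Decoration k 3) Prod.fst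
          (fun τ => GermIsNC τ.1 ∨ (Admissible τ.1 τ.2 ∧ (τ.2.head < δ.head ∨ (τ.2.head = δ.head ∧ ¬ UnaryVertex τ.2)))) (b, δ) := by
  intro k _ _ _ b δ hadm _hU hO ho hg
  have ho0 : δ.o ≠ 0 := by rw [ho]; exact two_ne_zero
  obtain ⟨Φ, u, a, hΦ0, hΦdet, hE, hu, ha, hWf⟩ := Decoration.exists_weierstrassWitness_of_goodDir hadm.2.1.ne_zero ho0 hg
  rw [ho] at hWf
  by_cases hirr : Irreducible (X 0 ^ 2 + ∑ i ∈ Finset.range 2, a i * X 0 ^ i : MvPowerSeries (Fin 4) k)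
  · have hsc := cpScopeOfTwoIrred k b δ Φ u _ a hadm ho hΦ0 hΦdet hE hu ha rfl hWf hirr
    exact hC 2 Nat.prime_two k b δ Φ u _ a hadm hO ho hΦ0 hΦdet hE hu ha rfl hWf hirr hsc
  · obtain ⟨d₁, d₂, bc, cc, hd₁, hd₂, hsum, hbc, hcc, hfac⟩ :=
      weierstrassFactorsOfReducible 2 Nat.prime_two k b δ Φ u _ a hadm ho hΦ0 hΦdet hu ha rfl hWf hirr
    have hd₁1 : d₁ = 1 := by omega
    have hd₂1 : d₂ = 1 := by omega
    subst hd₁1 hd₂1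
    have hfac' : X 0 ^ 2 + ∑ i ∈ Finset.range 2, a i * X 0 ^ i = (X 0 + bc 0) * (X 0 + cc 0) := by
      rw [hfac]; simp
    rw [hfac'] at hWf
    exact smoothPairTwo_charP 2 Nat.prime_two k b δ Φ u (bc 0) (cc 0) hadm hO ho hΦ0 hΦdet hE hu (hbc 0) (hcc 0) hWf

end TameFourTupleDrop

end Summit.ResolutionOfSingularities.ResolutionOfSingularities.Theorems

end
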